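import Summits.Ventures.QEC.Thresholds.PlanarSurfaceCodePhenomSAWBox
import Literature.InformationTheory.QuantumCodes.PlanarCodeCrossingPathsInhomogeneous
import HarnessLib

/-!
# Planar surface codes, code capacity with INHOMOGENEOUS independent noise: every family of qubit-dependent rates
# `p_{k,v} ≤ ρ < p₀(2.6939)` (in particular `ρ ≤ .0357`) is below threshold — unconditional, tier CERTIFIED (kernel)

Venture QEC, `Summits/Ventures/QEC/Thresholds/` (LADDER-QEC rung Q5, PARTITION row 09; qec-type-09 gen 6, cell item 135
«09.PSAW», part (D)). lit-2's `planar_codeCapacityThreshold_inhom` (`PlanarSurfaceCodeAnisotropic.lean`, 09.ANISO) certifies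
the planar surface codes against site-dependent independent flips at the cluster-expansion value: rates `≤ ρ` with
`36ρ(1-ρ) < 1` (`ρ < p₀(3) ≈ .0286`). With the SAW route (`PlanarCodeCrossingPathsInhomogeneous.lean`: the odd-crossing
residual bound for `indepWeight r`, rates `≤ ρ ≤ 1/2`) the same robustness statement holds up to `p₀(μ(ℤ²))`:

| theorem | statement | tier |
|---|---|---|
| `planar_inhom_belowThreshold_of_sawCountBound` | `cₙ ≤ C νⁿ`, rates `≤ ρ ≤ 1/2`, `4ν²ρ(1-ρ) < 1` ⇒ `Σ_{fails} w_r(e) → 0`, every minimum-weight decoder family of the `H_X`-sector | CERTIFIED (kernel), parametric |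
| `planar_inhom_belowThreshold_of_connectiveConstant_le` | `μ(ℤ²) ≤ μ'`, rates `≤ ρ < p₀(μ')` ⇒ `→ 0` | CERTIFIED (kernel), parametric |
| ★ `planar_inhom_belowThreshold_kernelSymmK16`, `planar_inhom_belowThreshold_0357` | rates `≤ ρ < p₀(2.6939)`, resp. `≤ ρ ≤ .0357` ⇒ `→ 0` (was `36ρ(1-ρ) < 1`) | CERTIFIED (kernel), unconditional |

HONEST FRAMING: one sector (`H_X`); the failure functional is the inhomogeneous failure sum of lit-2's theorem (not a
threshold VALUE statement, since the rates vary with the qubit); certified at the kernel certificate `μ(ℤ²) ≤ 2.6939`.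
No `native_decide`, no named fact, axioms standard.

## References

* [DennisEtAl2002] E. Dennis, A. Kitaev, A. Landahl, J. Preskill, *Topological quantum memory*, J. Math. Phys. 43 (2002)
  4452–4505, arXiv:quant-ph/0110143, §4.1 (independent errors), §5.3 eqs. (threshold_2d), (fail_2d).
* [PonitzTittmann2000] A. Pönitz, P. Tittmann, Electron. J. Combin. 7 (2000) R21, Table 2 (`d = 2, k = 16`: `2.6939`).
-/

noncomputable section

namespace Summit.Ventures.QEC.Thresholds

open Filter Topology Finset Matrix
open Literature.InformationTheory.QuantumCodes
open Literature.InformationTheory.QuantumCodes.PlanarCode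
open Literature.InformationTheory.QuantumCodes.ToricCode (SAWCountBound)
open Literature.Probability.RandomPlanarGeometry

open Classical in
/-- The inhomogeneous failure sum is at most the inhomogeneous probability of an odd-crossing residual.
[cite: DennisEtAl2002, §5.2 (Prob_fail ≤ the probability of a non-trivial (relative) polygon)] -/
theorem planar_inhom_failure_le_sum_oddResidual (k : ℕ) {D : Decoder (PlanarCheck k → ZMod 2) (PlanarQubit k → ZMod 2)}
    (hD : D.IsMinWeight (fun e => planarHX k *ᵥ e) {x | planarHX k *ᵥ x = 0} hammingNorm)
    {r : PlanarQubit k → ℝ} (hr0 : ∀ v, 0 ≤ r v) (hr1 : ∀ v, r v ≤ 1) :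
    (∑ e ∈ univ.filter (fun e : PlanarQubit k → ZMod 2 =>
        ¬ D.Corrects (fun e => planarHX k *ᵥ e) (planarSZ k : Set (PlanarQubit k → ZMod 2)) e),
        indepWeight r (supp e)) ≤
      ∑ e ∈ univ.filter (fun e : PlanarQubit k → ZMod 2 =>
        ∑ b : Fin (k + 2), (D (planarHX k *ᵥ e) + e) (Sum.inl (0, b)) = 1), indepWeight r (supp e) := by
  refine Finset.sum_le_sum_of_subset_of_nonneg (fun e he => ?_) fun e _ _ => indepWeight_nonneg hr0 hr1 _
  rw [Finset.mem_filter] at he ⊢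
  exact ⟨Finset.mem_univ _, planar_oddResidual_of_not_corrects k hD he.2⟩

open Classical in
/-- **Inhomogeneous noise below `4ν² ρ(1-ρ) < 1`** (given `cₙ ≤ C νⁿ`, `ν > 0`): for every minimum-weight decoder family of
the `H_X`-sector and every family of qubit-dependent flip rates `0 ≤ p_{k,v} ≤ ρ ≤ 1/2`, the failure probability tends to `0`.
[cite: DennisEtAl2002, §5.3 eq. (threshold_2d)] -/
theorem planar_inhom_belowThreshold_of_sawCountBound {C ν : ℝ} (hν : 0 < ν) (hC : SAWCountBound C ν)
    (D : ∀ k, Decoder (PlanarCheck k → ZMod 2) (PlanarQubit k → ZMod 2))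
    (hD : ∀ k, (D k).IsMinWeight (fun e => planarHX k *ᵥ e) {x | planarHX k *ᵥ x = 0} hammingNorm)
    {rate : ∀ k, PlanarQubit k → ℝ} {ρ : ℝ} (hr0 : ∀ k v, 0 ≤ rate k v) (hrρ : ∀ k v, rate k v ≤ ρ) (hρ0 : 0 ≤ ρ)
    (hρ : ρ ≤ 1 / 2) (h4 : 4 * ν ^ 2 * (ρ * (1 - ρ)) < 1) :
    Tendsto (fun k => ∑ e ∈ univ.filter (fun e : PlanarQubit k → ZMod 2 =>
        ¬ (D k).Corrects (fun e => planarHX k *ᵥ e) (planarSZ k : Set (PlanarQubit k → ZMod 2)) e),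
        indepWeight (rate k) (supp e)) atTop (𝓝 0) := by
  have ht := tendsto_sum_indepWeight_oddResidual hν hC D hD hr0 hrρ hρ0 hρ h4
  have hr1 : ∀ k v, rate k v ≤ 1 := fun k v => (hrρ k v).trans (by linarith)
  refine squeeze_zero' (Filter.Eventually.of_forall fun k => ?_)
    (Filter.Eventually.of_forall fun k => planar_inhom_failure_le_sum_oddResidual k (hD k) (hr0 k) (hr1 k)) ht
  exact Finset.sum_nonneg fun e _ => indepWeight_nonneg (hr0 k) (hr1 k) _

open Classical in
/-- **Inhomogeneous noise from any bound on the connective constant**: if `μ(ℤ²) ≤ μ'` (`μ' ≥ 1`) and all rates are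
`≤ ρ < p₀(μ')`, the failure probability of every minimum-weight decoder family of the `H_X`-sector tends to `0`.
[cite: DennisEtAl2002, §5.3 eqs. (saw_2), (threshold_2d)] -/
theorem planar_inhom_belowThreshold_of_connectiveConstant_le {μ' : ℝ} (hμ'1 : 1 ≤ μ')
    (hμ : SAW.Zd.connectiveConstant 2 ≤ μ') (D : ∀ k, Decoder (PlanarCheck k → ZMod 2) (PlanarQubit k → ZMod 2))
    (hD : ∀ k, (D k).IsMinWeight (fun e => planarHX k *ᵥ e) {x | planarHX k *ᵥ x = 0} hammingNorm)
    {rate : ∀ k, PlanarQubit k → ℝ} {ρ : ℝ} (hr0 : ∀ k v, 0 ≤ rate k v) (hrρ : ∀ k v, rate k v ≤ ρ) (hρ0 : 0 ≤ ρ)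
    (hρ : ρ < thresholdValue μ') :
    Tendsto (fun k => ∑ e ∈ univ.filter (fun e : PlanarQubit k → ZMod 2 =>
        ¬ (D k).Corrects (fun e => planarHX k *ᵥ e) (planarSZ k : Set (PlanarQubit k → ZMod 2)) e),
        indepWeight (rate k) (supp e)) atTop (𝓝 0) := by
  obtain ⟨ν, hν, h4⟩ := exists_gt_four_mul_sq_lt_one_of_lt_thresholdValue hμ'1 hρ0 hρ
  obtain ⟨C, hC⟩ := exists_sawCountBound_of_connectiveConstant_lt (lt_of_le_of_lt hμ hν)
  exact planar_inhom_belowThreshold_of_sawCountBound (by linarith) hC D hD hr0 hrρ hρ0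
    (hρ.le.trans (thresholdValue_le_half μ')) h4

open Classical in
/-- ★ **Planar surface codes are below threshold under EVERY inhomogeneous independent noise with rates `≤ ρ < p₀(2.6939)`**
(`H_X`-sector, every minimum-weight decoder family) — UNCONDITIONAL, tier CERTIFIED (kernel); was `36ρ(1-ρ) < 1`.
[cite: DennisEtAl2002, §5.3 eq. (threshold_2d)] [cite: PonitzTittmann2000, Table 2 (d = 2, k = 16)] -/
theorem planar_inhom_belowThreshold_kernelSymmK16 (D : ∀ k, Decoder (PlanarCheck k → ZMod 2) (PlanarQubit k → ZMod 2))
    (hD : ∀ k, (D k).IsMinWeight (fun e => planarHX k *ᵥ e) {x | planarHX k *ᵥ x = 0} hammingNorm)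
    {rate : ∀ k, PlanarQubit k → ℝ} {ρ : ℝ} (hr0 : ∀ k v, 0 ≤ rate k v) (hrρ : ∀ k v, rate k v ≤ ρ) (hρ0 : 0 ≤ ρ)
    (hρ : ρ < thresholdValue 2.6939) :
    Tendsto (fun k => ∑ e ∈ univ.filter (fun e : PlanarQubit k → ZMod 2 =>
        ¬ (D k).Corrects (fun e => planarHX k *ᵥ e) (planarSZ k : Set (PlanarQubit k → ZMod 2)) e),
        indepWeight (rate k) (supp e)) atTop (𝓝 0) :=
  planar_inhom_belowThreshold_of_connectiveConstant_le (by norm_num) SAW.Zd.connectiveConstant_two_le_26939 D hD hr0 hrρ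
    hρ0 hρ

open Classical in
/-- Decimal form: **all rates `≤ ρ ≤ .0357` ⇒ failure probability `→ 0`** (planar `H_X`-sector, every minimum-weight decoder
family) — UNCONDITIONAL, tier CERTIFIED (kernel). [cite: DennisEtAl2002, §5.3 eq. (p_c_2d)] -/
theorem planar_inhom_belowThreshold_0357 (D : ∀ k, Decoder (PlanarCheck k → ZMod 2) (PlanarQubit k → ZMod 2))
    (hD : ∀ k, (D k).IsMinWeight (fun e => planarHX k *ᵥ e) {x | planarHX k *ᵥ x = 0} hammingNorm)
    {rate : ∀ k, PlanarQubit k → ℝ} {ρ : ℝ} (hr0 : ∀ k v, 0 ≤ rate k v) (hrρ : ∀ k v, rate k v ≤ ρ) (hρ0 : 0 ≤ ρ)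
    (hρ : ρ ≤ 0.0357) :
    Tendsto (fun k => ∑ e ∈ univ.filter (fun e : PlanarQubit k → ZMod 2 =>
        ¬ (D k).Corrects (fun e => planarHX k *ᵥ e) (planarSZ k : Set (PlanarQubit k → ZMod 2)) e),
        indepWeight (rate k) (supp e)) atTop (𝓝 0) :=
  planar_inhom_belowThreshold_kernelSymmK16 D hD hr0 hrρ hρ0 (lt_of_le_of_lt hρ thresholdValue_26939_bounds.1)

end Summit.Ventures.QEC.Thresholds
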